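import Literature.MathematicalPhysics.QuantumFieldTheory.Balaban1983to89.B15ComplexifiedDatumFamily
import Mathlib.Topology.Algebra.Module.Star

/-!
# `Balaban1983to89.B15Prop1StateChartSU2` — [Balaban1985Variational] = «[15]», Sect. G p. 305 («we fix a gauge condition for U_k(V′V₀)U₀⁻¹ … analytic function of B = (1∕i) log V′»),
# p. 307 («valid for Gᶜ-valued fields»), (181) p. 307; [Balaban1989LargeFieldI] = «[IV]», Prop. 1 p. 194 (last clause):
# THE COMPLEX EXPONENTIAL STATE CHART AT AN `SU(2)` CONFIGURATION AND THE COORDINATEWISE CONJUGATION — the `χ`, `cE` of `B15Prop1CriticalChartFromIFT`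

Honest framing: statement-level skeleton of published theorems with citation tags; proofs where landed; nothing here is a claim about the
Yang–Mills mass gap.  Cell `pub-ymgap`, HUMAN RULING D-0149 (width seats), seat `pub-ymgap-dag-n12-w1` (g2; N12 = [B15]; U1a⁺ of the w1 lineage, U1A-CENSUS §4 item 1 (δ′));
count-neutral; N12 NOT discharged; finite 𝕋⁴ at fixed ε; nothing continuum ∕ OS ∕ mass-gap ∕ Clay.

WHY.  `B15Prop1CriticalChartFromIFT.exists_localChart_of_criticalFamily` ∕ `hMin_of_criticalFamilies` (this seat) take ABSTRACT coordinates: a complex state space `E` with a conjugation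
`cE : E →L⋆[ℂ] E` and a state chart `χ : E → (bond ↦ M₂(ℂ))`, ℂ-differentiable, intertwining `cE` with the unitary real structure `θ(A) = (A⋆)⁻¹`, valued in `det = 1`.  THIS MODULE
supplies the N12 instance of that triple: `E := PBond P j → ℂ³` (complexified `𝔰𝔲(2)`-coordinates on ALL bonds), `cE :=` coordinatewise conjugation (`B15ComplexifiedDatumFamily.conjVec`)
realised as a continuous CONJUGATE-LINEAR map (its existence as such is a theorem here — no new definition), and `χ := X ↦ exp(Σ X_a E_a)·U₀` bondwise = this lineage's complexified
`expMul su2Chart` (`B15SU2ChartHolomorphic.expMulC X ↑U₀`) at a base `SU(2)` configuration `U₀`: ENTIRE, `θ(χ X) = χ X̄` (so `χ` of a real field is `SU(2)`-valued: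
`expMulC (cplxVec p) ↑U₀ = ↑(expMul su2Chart p U₀)`), `det = 1`, fixed points of `cE` = the real fields.

CONTENTS (theorems only; no `def`, no `instance`, no `sorry`).  §1 `conjVec_add`, `conjVec_smul`, `continuous_conjVec`, ★ `exists_conjCLM` (∃ `cE : E →L⋆[ℂ] E` with `cE = conjVec`),
`exists_conjCLM_pi` (the same on any `ι → ℂ³`, e.g. the constraint-value space, with involutivity),
`conjVec_conjVec`, `conjVec_eq_self_iff` (fixed ⇔ real: `X = cplxVec p`).  §2 ★ `expMulC_conjVec_coeField` (`θ`-equivariance at an `SU(2)` base), `det_expMulC_coeField`,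
`differentiable_expMulC_right` (entire in `X`), `analyticAt_expPointC`, ★ `analyticAt_expMulC_right` ∕ `contDiffAt_expMulC_right` (the class the implicit-function theorem
asks), `expMulC_cplxVec_coeField_eq` (real fields give `SU(2)` configurations).
-/

noncomputable section

namespace Literature.MathematicalPhysics.QuantumFieldTheory.Balaban1983to89.B15Prop1StateChartSU2

open scoped ComplexConjugate
open Literature.MathematicalPhysics.QuantumFieldTheory.Balaban1983to89.Node00 (SU coeField coeField_apply)
open B15ComplexifiedDatumFamily (conjVec conjVec_cplxVec)
open B15SU2ChartHolomorphic (expPointC expMulC expMulC_cplxVec_coeField differentiableAt_expMulC det_expMulC expMulC_theta)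
open B15Prop1AnalyticExtClause (cplxVec)
open B15Prop1ChartCalculusSU2 (E3)
open B15Prop1ChartSU2 (su2Chart)
open B16Sect1Backgrounds (expMul)
open T4CubeChartGnomonic (SU2)
open T4Continuum B15DeterminingSets GaugeField
open scoped Matrix.Norms.L2Operator

variable {P : Params} {j : ℕ}

/-! ## §1  Coordinatewise conjugation as a continuous conjugate-linear involution; its fixed points are the real fields -/

section Conj

/-- `conjVec` is additive. [cite: Balaban1985Variational, p.307 (bookkeeping)] -/
theorem conjVec_add (X Y : VecField P j (EuclideanSpace ℂ (Fin 3))) : conjVec (X + Y) = conjVec X + conjVec Y := by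
  funext b; ext a; simp [conjVec]

/-- `conjVec` is conjugate-homogeneous: `conjVec (c • X) = c̄ • conjVec X`. [cite: Balaban1985Variational, p.307 (bookkeeping)] -/
theorem conjVec_smul (c : ℂ) (X : VecField P j (EuclideanSpace ℂ (Fin 3))) : conjVec (c • X) = (conj c) • conjVec X := by
  funext b; ext a; simp [conjVec]

/-- `conjVec` is continuous. [cite: Balaban1985Variational, p.307 (bookkeeping)] -/
theorem continuous_conjVec : Continuous (conjVec : VecField P j (EuclideanSpace ℂ (Fin 3)) → VecField P j (EuclideanSpace ℂ (Fin 3))) := by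
  refine continuous_pi fun b => ?_
  refine (PiLp.continuous_toLp 2 _).comp ?_
  refine continuous_pi fun a => ?_
  exact Complex.continuous_conj.comp ((PiLp.continuous_apply 2 _ a).comp (continuous_apply b))

/-- ★ **COORDINATEWISE CONJUGATION IS A CONTINUOUS CONJUGATE-LINEAR MAP** — the conjugation `cE` of the abstract chart theorem, on the N12 coordinate space `PBond P j → ℂ³` (existence as a
theorem; no new definition). [cite: Balaban1985Variational, p.307 («Gᶜ-valued fields»), (181) p.307] -/
theorem exists_conjCLM : ∃ cE : VecField P j (EuclideanSpace ℂ (Fin 3)) →L⋆[ℂ] VecField P j (EuclideanSpace ℂ (Fin 3)), ∀ X, cE X = conjVec X :=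
  ⟨{ toFun := conjVec, map_add' := conjVec_add, map_smul' := conjVec_smul, cont := continuous_conjVec }, fun _ => rfl⟩

/-- **COORDINATEWISE CONJUGATION ON ANY FINITE PRODUCT OF `ℂ³`'s** (e.g. the constraint-value space `Fin m → ℂ³` of the datum coordinates) is a continuous conjugate-linear INVOLUTION,
characterised pointwise — the conjugation `cF` of the abstract chart theorem (existence as a theorem; no new definition). [cite: Balaban1985Variational, p.307, (181) p.307] -/
theorem exists_conjCLM_pi (ι : Type*) :
    ∃ c : (ι → EuclideanSpace ℂ (Fin 3)) →L⋆[ℂ] (ι → EuclideanSpace ℂ (Fin 3)),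
      (∀ v i a, c v i a = conj (v i a)) ∧ ∀ v, c (c v) = v := by
  refine ⟨{ toFun := fun v i => WithLp.toLp 2 fun a => conj (v i a), map_add' := ?_, map_smul' := ?_, cont := ?_ }, fun v i a => rfl, fun v => ?_⟩
  · intro v w; funext i; ext a; simp
  · intro c v; funext i; ext a; simp
  · refine continuous_pi fun i => (PiLp.continuous_toLp 2 _).comp (continuous_pi fun a => ?_)
    exact Complex.continuous_conj.comp ((PiLp.continuous_apply 2 _ a).comp (continuous_apply i))
  · funext i; ext a
    show conj (conj (v i a)) = v i a
    exact Complex.conj_conj _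

/-- `conjVec` is an involution. [cite: Balaban1985Variational, p.307 (bookkeeping)] -/
theorem conjVec_conjVec (X : VecField P j (EuclideanSpace ℂ (Fin 3))) : conjVec (conjVec X) = X := by
  funext b; ext a; simp [conjVec]

/-- **FIXED POINTS = REAL FIELDS**: `conjVec X = X` iff `X = cplxVec p` for a (unique) real bond field `p`. [cite: Balaban1989LargeFieldI, Prop. 1 p.194 («B′ ∈ 𝔤ᶜ»); Balaban1985Variational, p.307] -/
theorem conjVec_eq_self_iff (X : VecField P j (EuclideanSpace ℂ (Fin 3))) : conjVec X = X ↔ ∃ p : VecField P j E3, X = cplxVec p := by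
  constructor
  · intro h
    refine ⟨fun b => WithLp.toLp 2 fun a => (X b a).re, funext fun b => ?_⟩
    ext a
    have hba : conj (X b a) = X b a := by
      have := congrArg (fun Y : VecField P j (EuclideanSpace ℂ (Fin 3)) => Y b a) h
      simpa [conjVec] using this
    have him : (X b a).im = 0 := by
      have := congrArg Complex.im hba
      simp at this
      linarith
    simp only [cplxVec]
    exact Complex.ext (by simp) (by simp [him])
  · rintro ⟨p, rfl⟩
    exact conjVec_cplxVec p

end Conj

/-! ## §2  The complex exponential state chart `X ↦ exp(Σ X_a E_a)·U₀` at an `SU(2)` configuration -/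

section Chart

/-- For an `SU(2)` matrix, `(U⋆)⁻¹ = U`. [cite: Balaban1985Variational, p.307 (bookkeeping)] -/
theorem star_inv_coe_SU2 (U : SU2) : (star ((U : SU2) : Matrix (Fin 2) (Fin 2) ℂ))⁻¹ = ((U : SU2) : Matrix (Fin 2) (Fin 2) ℂ) := by
  have hU : star ((U : SU2) : Matrix (Fin 2) (Fin 2) ℂ) * ((U : SU2) : Matrix (Fin 2) (Fin 2) ℂ) = 1 :=
    Matrix.mem_unitaryGroup_iff'.1 (Matrix.mem_specialUnitaryGroup_iff.1 U.2).1
  exact Matrix.inv_eq_right_inv hU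

/-- ★ **`θ`-EQUIVARIANCE OF THE STATE CHART AT AN `SU(2)` BASE**: `χ (X̄) = θ (χ X)` bondwise for `χ X = expMulC X ↑U₀` — the hypothesis `hχθ` of
`B15Prop1CriticalChartFromIFT.exists_localChart_of_criticalFamily`. [cite: Balaban1985Variational, p.307, (181) p.307, Prop. 9 p.309] -/
theorem expMulC_conjVec_coeField (U₀ : GaugeField P j SU2) (X : VecField P j (EuclideanSpace ℂ (Fin 3))) (b : PBond P j) :
    expMulC (conjVec X) (coeField U₀) b = (star (expMulC X (coeField U₀) b))⁻¹ := by
  rw [expMulC_theta]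
  show expMulC (conjVec X) (coeField U₀) b = expMulC (conjVec X) (fun b' => (star (coeField U₀ b'))⁻¹) b
  congr 2
  funext b'
  rw [coeField_apply, star_inv_coe_SU2]

/-- **DETERMINANT ONE**: `det (χ X b) = 1` — the hypothesis `hχdet`. [cite: Balaban1985Variational, p.307 (bookkeeping)] -/
theorem det_expMulC_coeField (U₀ : GaugeField P j SU2) (X : VecField P j (EuclideanSpace ℂ (Fin 3))) (b : PBond P j) :
    (expMulC X (coeField U₀) b).det = 1 := by
  rw [det_expMulC, coeField_apply]
  exact (Matrix.mem_specialUnitaryGroup_iff.1 (U₀ b).2).2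

/-- **THE STATE CHART IS ENTIRE** in the coordinates `X` (at a fixed base) — the hypothesis `hχ` (everywhere). [cite: Balaban1985Variational, Sect. G p.305, Prop. 9 p.309] -/
theorem differentiable_expMulC_right (W : PBond P j → Matrix (Fin 2) (Fin 2) ℂ) :
    Differentiable ℂ (fun X : VecField P j (EuclideanSpace ℂ (Fin 3)) => expMulC X W) :=
  fun _ => differentiableAt_expMulC differentiableAt_id (differentiableAt_const _)

/-- **THE ONE-BOND CHART IS ANALYTIC**: `z ↦ exp(Σ z_a E_a)` is `ℂ`-analytic everywhere (the exponential series of a complete normed algebra, composed with a linear map).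
[cite: Balaban1985Variational, Sect. G p.305 («analytic function of B = (1∕i) log V′»), Prop. 9 p.309] -/
theorem analyticAt_expPointC (z : EuclideanSpace ℂ (Fin 3)) : AnalyticAt ℂ expPointC z := by
  have hL : AnalyticAt ℂ (fun w : EuclideanSpace ℂ (Fin 3) => ∑ a : Fin 3, w a • B15SU2ChartHolomorphic.genE a) z :=
    Finset.analyticAt_fun_sum _ fun a _ => ((EuclideanSpace.proj a : EuclideanSpace ℂ (Fin 3) →L[ℂ] ℂ).analyticAt z).smul analyticAt_const
  exact (NormedSpace.exp_analytic (𝕂 := ℂ) _).comp hL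

/-- ★ **THE STATE CHART IS ANALYTIC** in the coordinates (at a fixed base): every class `C^n`, `n ≤ ω`, that the implicit-function theorem asks of the action and the constraint through `χ`
is available. [cite: Balaban1985Variational, Sect. G p.305, Prop. 9 p.309] -/
theorem analyticAt_expMulC_right (W : PBond P j → Matrix (Fin 2) (Fin 2) ℂ) (X : VecField P j (EuclideanSpace ℂ (Fin 3))) :
    AnalyticAt ℂ (fun X : VecField P j (EuclideanSpace ℂ (Fin 3)) => expMulC X W) X := by
  refine analyticAt_pi_iff.2 fun b => ?_
  show AnalyticAt ℂ (fun X : VecField P j (EuclideanSpace ℂ (Fin 3)) => expPointC (X b) * W b) X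
  have hb : AnalyticAt ℂ (fun X : VecField P j (EuclideanSpace ℂ (Fin 3)) => X b) X :=
    (ContinuousLinearMap.proj (R := ℂ) (φ := fun _ : PBond P j => EuclideanSpace ℂ (Fin 3)) b).analyticAt X
  exact ((analyticAt_expPointC _).comp hb).mul analyticAt_const

/-- The state chart is `C^n` for every `n` (in particular `C^{m+1}` as `exists_localChart_of_criticalFamily` asks). [cite: Balaban1985Variational, Sect. G p.305 (bookkeeping)] -/
theorem contDiffAt_expMulC_right (W : PBond P j → Matrix (Fin 2) (Fin 2) ℂ) (X : VecField P j (EuclideanSpace ℂ (Fin 3))) {n : WithTop ℕ∞} :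
    ContDiffAt ℂ n (fun X : VecField P j (EuclideanSpace ℂ (Fin 3)) => expMulC X W) X :=
  (analyticAt_expMulC_right W X).contDiffAt

/-- **REAL COORDINATES GIVE `SU(2)` CONFIGURATIONS**: at a real field the state chart is the matrix field of the chart configuration of record `expMul su2Chart p U₀`.
[cite: Balaban1989LargeFieldI, Prop. 1 p.194; Balaban1985Variational, Sect. G p.305] -/
theorem expMulC_cplxVec_coeField_eq (U₀ : GaugeField P j SU2) (p : VecField P j E3) :
    expMulC (cplxVec p) (coeField U₀) = coeField (expMul su2Chart p U₀) :=
  expMulC_cplxVec_coeField p U₀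

end Chart

end Literature.MathematicalPhysics.QuantumFieldTheory.Balaban1983to89.B15Prop1StateChartSU2

end
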